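import Mathlib
import Summits.ValiantsHypothesis.ValiantsHypothesis.Theorems.KPlusLogSqLawLiftingLaguerreTwoPoint

/-!
# Local Descartes rule, dominance bookkeeping: the signs of the two-point entries outside the window

HONEST FRAMING.  Helper file toward the lifting crux `WeakLifting` (stmt-ValiantsHypothesis-19561; aside `Lifting`
stmt-ValiantsHypothesis-19772, registered stub `stub_liftThin`) of route `KPlusLogSqLaw` (cell `pub-symmetroid`, seat
val-sym-lift-p1 g8, 2026-08-27).  Elementary facts about ONE real polynomial / real sequences; nothing here asserts `WeakLifting`,
`TropicalB`, Conjecture B, `MatrixDescartes` (stmt-ValiantsHypothesis-18050) or anything about VP ≠ VNP.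

For `f = Σ c_i X^i`, `0 < a < b` and the two-point entries `E_j = b^j Σ_{i ≥ j} c_i a^i + a^j Σ_{i<j} c_i b^i` of
`…LiftingLaguerreTwoPoint`: if the monomial `x^u` DOMINATES `f` at `a` (`Σ_{i ≠ u} |c_i| a^i < |c_u| a^u`, the archimedean
dominance of `…LiftingNewtonWindows`) then `c_u · E_j > 0` for every `j ≤ u` (`coeff_mul_twoPointEntry_pos_of_le`); if `x^w`
dominates at `b` then `c_w · E_j > 0` for every `w ≤ j ≤ n + 1` (`coeff_mul_twoPointEntry_pos_of_ge`).  Tools: a dominant term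
decides the sign of a finite sum (`mul_sum_pos_of_dominant`), weighted off-index coefficient sums are controlled by the dominance
margin (`sum_erase_le_support`), `a^j b^i ≤ b^j a^i` for `i ≤ j`.  No `def`.
[folklore]
-/

set_option linter.dupNamespace false
set_option autoImplicit false

namespace Summit.ValiantsHypothesis.ValiantsHypothesis.Theorems.KPlusLogSqLaw.LocalDescartes

open Set Finset
open scoped BigOperators
open Literature.Algebra.Polynomial (signVar signVarAux)
open Literature.Computability.AlgebraicComplexity.BD17 (signVar_cons_cons_of_ne_zero)

/-! ## Dominance bookkeeping -/

/-- a dominant term decides the sign of a finite sum. [folklore] -/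
theorem mul_sum_pos_of_dominant {s : Finset ℕ} {x : ℕ → ℝ} {u : ℕ} (hu : u ∈ s)
    (h : ∑ i ∈ s.erase u, |x i| < |x u|) : 0 < x u * ∑ i ∈ s, x i := by
  rw [← Finset.add_sum_erase s x hu]
  have hR : |∑ i ∈ s.erase u, x i| < |x u| := (Finset.abs_sum_le_sum_abs _ _).trans_lt h
  have hxu : x u ≠ 0 := fun h0 => by rw [h0, abs_zero] at hR; exact absurd hR (not_lt.mpr (abs_nonneg _))
  rw [abs_lt] at hR
  rcases lt_or_gt_of_ne hxu with hneg | hpos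
  · rw [abs_of_neg hneg] at hR; nlinarith [hR.1, hR.2]
  · rw [abs_of_pos hpos] at hR; nlinarith [hR.1, hR.2]

/-- weighted coefficient sums off one index are controlled by the dominance margin: if `0 ≤ ω_i ≤ x^i` then
`Σ_{i ∈ T, i ≠ u} |c_i| ω_i ≤ Σ_{i ∈ supp f, i ≠ u} |c_i| x^i`. [folklore] -/
theorem sum_erase_le_support (f : Polynomial ℝ) (T : Finset ℕ) (u : ℕ) (ω : ℕ → ℝ) {x : ℝ} (hx : 0 ≤ x)
    (hω : ∀ i ∈ T, 0 ≤ ω i ∧ ω i ≤ x ^ i) :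
    ∑ i ∈ T.erase u, |f.coeff i| * ω i ≤ ∑ i ∈ f.support.erase u, |f.coeff i| * x ^ i := by
  classical
  calc ∑ i ∈ T.erase u, |f.coeff i| * ω i
      ≤ ∑ i ∈ T.erase u, |f.coeff i| * x ^ i := Finset.sum_le_sum fun i hi =>
        mul_le_mul_of_nonneg_left (hω i (Finset.mem_of_mem_erase hi)).2 (abs_nonneg _)
    _ = ∑ i ∈ (T.erase u).filter (fun i => i ∈ f.support), |f.coeff i| * x ^ i := by
        rw [Finset.sum_filter]
        refine Finset.sum_congr rfl fun i _ => ?_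
        split_ifs with h
        · rfl
        · rw [Polynomial.notMem_support_iff.mp h, abs_zero, zero_mul]
    _ ≤ ∑ i ∈ f.support.erase u, |f.coeff i| * x ^ i := by
        refine Finset.sum_le_sum_of_subset_of_nonneg (fun i hi => ?_) (fun i _ _ => mul_nonneg (abs_nonneg _) (pow_nonneg hx _))
        rw [Finset.mem_filter] at hi
        exact Finset.mem_erase.mpr ⟨(Finset.mem_erase.mp hi.1).1, hi.2⟩

/-- `a^j b^i ≤ b^j a^i` for `i ≤ j`, `0 < a ≤ b`. [folklore] -/
theorem pow_mul_pow_le_of_le {a b : ℝ} (ha : 0 < a) (hab : a ≤ b) {i j : ℕ} (hij : i ≤ j) :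
    a ^ j * b ^ i ≤ b ^ j * a ^ i := by
  obtain ⟨d, rfl⟩ := Nat.exists_eq_add_of_le hij
  have hd : a ^ d ≤ b ^ d := pow_le_pow_left₀ ha.le hab d
  have hb : 0 < b := lt_of_lt_of_le ha hab
  calc a ^ (i + d) * b ^ i = (a ^ i * b ^ i) * a ^ d := by ring
    _ ≤ (a ^ i * b ^ i) * b ^ d := mul_le_mul_of_nonneg_left hd (by positivity)
    _ = b ^ (i + d) * a ^ i := by ring

/-- **Sign of the two-point entries below the first dominant exponent.**  If `x^u` dominates `f` at `a` (`0 < a < b`) then for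
`j ≤ u ≤ n`: `c_u · E_j > 0`, `E_j = b^j Σ_{i ≥ j} c_i a^i + a^j Σ_{i<j} c_i b^i`. [folklore] -/
theorem coeff_mul_twoPointEntry_pos_of_le (f : Polynomial ℝ) {a b : ℝ} (ha : 0 < a) (hab : a < b) {u j : ℕ}
    (hju : j ≤ u) (hun : u ≤ f.natDegree)
    (hdomA : ∑ i ∈ f.support.erase u, |f.coeff i| * a ^ i < |f.coeff u| * a ^ u) :
    0 < f.coeff u * (b ^ j * (∑ i ∈ Finset.Icc j f.natDegree, f.coeff i * a ^ i)
      + a ^ j * (∑ i ∈ Finset.range j, f.coeff i * b ^ i)) := by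
  classical
  have hb : 0 < b := ha.trans hab
  set n := f.natDegree
  -- one sum over `range (n+1)`
  set x : ℕ → ℝ := fun i => if j ≤ i then b ^ j * (f.coeff i * a ^ i) else a ^ j * (f.coeff i * b ^ i) with hx
  have hsplit : b ^ j * (∑ i ∈ Finset.Icc j n, f.coeff i * a ^ i) + a ^ j * (∑ i ∈ Finset.range j, f.coeff i * b ^ i)
      = ∑ i ∈ Finset.range (n + 1), x i := by
    have hunion : Finset.range (n + 1) = Finset.range j ∪ Finset.Icc j n := by
      ext i; simp [Finset.mem_Icc]; omega
    have hdisj : Disjoint (Finset.range j) (Finset.Icc j n) := by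
      rw [Finset.disjoint_left]; intro i h1 h2; simp [Finset.mem_Icc] at h1 h2; omega
    rw [hunion, Finset.sum_union hdisj, add_comm, Finset.mul_sum, Finset.mul_sum]
    congr 1
    · refine Finset.sum_congr rfl fun i hi => ?_
      rw [hx]; simp only; rw [if_neg (not_le.mpr (Finset.mem_range.mp hi))]
    · refine Finset.sum_congr rfl fun i hi => ?_
      rw [hx]; simp only; rw [if_pos (Finset.mem_Icc.mp hi).1]
  rw [hsplit]
  have hu : u ∈ Finset.range (n + 1) := Finset.mem_range.mpr (by omega)
  have hxu : x u = b ^ j * (f.coeff u * a ^ u) := by rw [hx]; simp only; rw [if_pos hju]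
  have habs : ∀ i, |x i| ≤ b ^ j * (|f.coeff i| * a ^ i) := by
    intro i; rw [hx]; simp only
    split_ifs with h
    · rw [abs_mul, abs_mul, abs_of_pos (pow_pos hb _), abs_of_pos (pow_pos ha _)]
    · rw [abs_mul, abs_mul, abs_of_pos (pow_pos ha _), abs_of_pos (pow_pos hb _)]
      have := pow_mul_pow_le_of_le ha hab.le (not_le.mp h).le
      calc a ^ j * (|f.coeff i| * b ^ i) = |f.coeff i| * (a ^ j * b ^ i) := by ring
        _ ≤ |f.coeff i| * (b ^ j * a ^ i) := mul_le_mul_of_nonneg_left this (abs_nonneg _)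
        _ = b ^ j * (|f.coeff i| * a ^ i) := by ring
  have hbound : ∑ i ∈ (Finset.range (n + 1)).erase u, |x i| < |x u| := by
    have h1 : ∑ i ∈ (Finset.range (n + 1)).erase u, |x i|
        ≤ b ^ j * ∑ i ∈ (Finset.range (n + 1)).erase u, |f.coeff i| * a ^ i := by
      rw [Finset.mul_sum]; exact Finset.sum_le_sum fun i _ => habs i
    have h2 := sum_erase_le_support f (Finset.range (n + 1)) u (fun i => a ^ i) ha.le
      (fun i _ => ⟨pow_nonneg ha.le _, le_rfl⟩)
    calc _ ≤ b ^ j * ∑ i ∈ (Finset.range (n + 1)).erase u, |f.coeff i| * a ^ i := h1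
      _ ≤ b ^ j * ∑ i ∈ f.support.erase u, |f.coeff i| * a ^ i := mul_le_mul_of_nonneg_left h2 (pow_nonneg hb.le _)
      _ < b ^ j * (|f.coeff u| * a ^ u) := mul_lt_mul_of_pos_left hdomA (pow_pos hb _)
      _ = |x u| := by rw [hxu, abs_mul, abs_mul, abs_of_pos (pow_pos hb _), abs_of_pos (pow_pos ha _)]
  have key := mul_sum_pos_of_dominant (x := x) hu hbound
  rw [hxu] at key
  have hbj : 0 < b ^ j * a ^ u := by positivity
  by_contra hneg
  push Not at hneg
  have : b ^ j * (f.coeff u * a ^ u) * ∑ i ∈ Finset.range (n + 1), x i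
      = (b ^ j * a ^ u) * (f.coeff u * ∑ i ∈ Finset.range (n + 1), x i) := by ring
  rw [this] at key
  exact absurd key (not_lt.mpr (mul_nonpos_of_nonneg_of_nonpos hbj.le hneg))

/-- **Sign of the two-point entries above the second dominant exponent.**  If `x^w` dominates `f` at `b` (`0 < a < b`) then for
`w ≤ j ≤ n + 1`: `c_w · E_j > 0`. [folklore] -/
theorem coeff_mul_twoPointEntry_pos_of_ge (f : Polynomial ℝ) {a b : ℝ} (ha : 0 < a) (hab : a < b) {w j : ℕ}
    (hwj : w ≤ j) (hjn : j ≤ f.natDegree + 1)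
    (hdomB : ∑ i ∈ f.support.erase w, |f.coeff i| * b ^ i < |f.coeff w| * b ^ w) :
    0 < f.coeff w * (b ^ j * (∑ i ∈ Finset.Icc j f.natDegree, f.coeff i * a ^ i)
      + a ^ j * (∑ i ∈ Finset.range j, f.coeff i * b ^ i)) := by
  classical
  have hb : 0 < b := ha.trans hab
  have hcw : f.coeff w ≠ 0 := by
    intro h; rw [h, abs_zero, zero_mul] at hdomB
    exact absurd hdomB (not_lt.mpr (Finset.sum_nonneg fun i _ => mul_nonneg (abs_nonneg _) (pow_nonneg hb.le _)))
  have hwn : w ≤ f.natDegree := Polynomial.le_natDegree_of_ne_zero hcw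
  set n := f.natDegree
  set x : ℕ → ℝ := fun i => if j ≤ i then b ^ j * (f.coeff i * a ^ i) else a ^ j * (f.coeff i * b ^ i) with hx
  have hsplit : b ^ j * (∑ i ∈ Finset.Icc j n, f.coeff i * a ^ i) + a ^ j * (∑ i ∈ Finset.range j, f.coeff i * b ^ i)
      = ∑ i ∈ Finset.range (n + 1), x i := by
    have hunion : Finset.range (n + 1) = Finset.range j ∪ Finset.Icc j n := by
      ext i; simp [Finset.mem_Icc]; omega
    have hdisj : Disjoint (Finset.range j) (Finset.Icc j n) := by
      rw [Finset.disjoint_left]; intro i h1 h2; simp [Finset.mem_Icc] at h1 h2; omega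
    rw [hunion, Finset.sum_union hdisj, add_comm, Finset.mul_sum, Finset.mul_sum]
    congr 1
    · refine Finset.sum_congr rfl fun i hi => ?_
      rw [hx]; simp only; rw [if_neg (not_le.mpr (Finset.mem_range.mp hi))]
    · refine Finset.sum_congr rfl fun i hi => ?_
      rw [hx]; simp only; rw [if_pos (Finset.mem_Icc.mp hi).1]
  rw [hsplit]
  have hw : w ∈ Finset.range (n + 1) := Finset.mem_range.mpr (by omega)
  have hxw : x w = a ^ j * (f.coeff w * b ^ w) := by
    rw [hx]; simp only
    by_cases h : j ≤ w
    · have : j = w := le_antisymm h hwj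
      subst this; rw [if_pos le_rfl]; ring
    · rw [if_neg h]
  have habs : ∀ i, |x i| ≤ a ^ j * (|f.coeff i| * b ^ i) := by
    intro i; rw [hx]; simp only
    split_ifs with h
    · rw [abs_mul, abs_mul, abs_of_pos (pow_pos hb _), abs_of_pos (pow_pos ha _)]
      have := pow_mul_pow_le_of_le ha hab.le h
      calc b ^ j * (|f.coeff i| * a ^ i) = |f.coeff i| * (a ^ i * b ^ j) := by ring
        _ ≤ |f.coeff i| * (b ^ i * a ^ j) := mul_le_mul_of_nonneg_left this (abs_nonneg _)
        _ = a ^ j * (|f.coeff i| * b ^ i) := by ring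
    · rw [abs_mul, abs_mul, abs_of_pos (pow_pos ha _), abs_of_pos (pow_pos hb _)]
  have hbound : ∑ i ∈ (Finset.range (n + 1)).erase w, |x i| < |x w| := by
    have h1 : ∑ i ∈ (Finset.range (n + 1)).erase w, |x i|
        ≤ a ^ j * ∑ i ∈ (Finset.range (n + 1)).erase w, |f.coeff i| * b ^ i := by
      rw [Finset.mul_sum]; exact Finset.sum_le_sum fun i _ => habs i
    have h2 := sum_erase_le_support f (Finset.range (n + 1)) w (fun i => b ^ i) hb.le
      (fun i _ => ⟨pow_nonneg hb.le _, le_rfl⟩)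
    calc _ ≤ a ^ j * ∑ i ∈ (Finset.range (n + 1)).erase w, |f.coeff i| * b ^ i := h1
      _ ≤ a ^ j * ∑ i ∈ f.support.erase w, |f.coeff i| * b ^ i := mul_le_mul_of_nonneg_left h2 (pow_nonneg ha.le _)
      _ < a ^ j * (|f.coeff w| * b ^ w) := mul_lt_mul_of_pos_left hdomB (pow_pos ha _)
      _ = |x w| := by rw [hxw, abs_mul, abs_mul, abs_of_pos (pow_pos ha _), abs_of_pos (pow_pos hb _)]
  have key := mul_sum_pos_of_dominant (x := x) hw hbound
  rw [hxw] at key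
  have haj : 0 < a ^ j * b ^ w := by positivity
  by_contra hneg
  push Not at hneg
  have : a ^ j * (f.coeff w * b ^ w) * ∑ i ∈ Finset.range (n + 1), x i
      = (a ^ j * b ^ w) * (f.coeff w * ∑ i ∈ Finset.range (n + 1), x i) := by ring
  rw [this] at key
  exact absurd key (not_lt.mpr (mul_nonpos_of_nonneg_of_nonpos haj.le hneg))


end Summit.ValiantsHypothesis.ValiantsHypothesis.Theorems.KPlusLogSqLaw.LocalDescartes
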